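import Summits.ResolutionOfSingularities.ResolutionOfSingularities.Theorems.EquisingularLiftEquisingularLiftNatFlatOfQuotientLevels
import Mathlib.RingTheory.Flat.Localization
import Mathlib.RingTheory.Flat.Stability
import Mathlib.RingTheory.TensorProduct.Quotient
import Mathlib.RingTheory.Localization.AtPrime.Basic
import Mathlib.RingTheory.Localization.Ideal
import Literature.AlgebraicGeometry.Morphisms.FormalFunctions
import Mathlib.AlgebraicGeometry.Morphisms.Flat
import Mathlib.AlgebraicGeometry.Noetherian
import HarnessLib

/-!
# [OURS · L1 W4.5(b) · EL♮(3) · (T-k) · joint J3, global and scheme forms] Flatness over a DVR from flatness of all truncations: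
# a Noetherian `O`-algebra all of whose base changes `(O/𝔪ⁿ⁺¹) ⊗_O B` are flat is flat; a locally Noetherian `T → Spec O` all of whose levels
# `T ×_O O/𝔪ⁿ⁺¹ → Spec O/𝔪ⁿ⁺¹` are flat is flat

Crux chain w45b (cell `res-hironaka`, slot W4.5(b)), working crux **EL♮** = stmt-ResolutionOfSingularities-20038, child **EL♮(3)** =
stmt-ResolutionOfSingularities-20148; NEED-FACT stub `stub_elnat_embeddedCurveLiftFact` and its discharge chain ((T-k) census
`Cruxes/EquisingularLiftNatThree/Lines/TK-CENSUS-res-type-027.md`, joints J1/J2/J3). Written by res-type-027 g16. This file globalises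
res-L1-w45b-lead-2 g4's J3 `flat_of_forall_flat_quotient_pow` (…NatFlatOfQuotientLevels, p596343: the LOCAL statement — a Noetherian local
`O`-algebra with local structure map and flat truncations is flat; EGA 0_III (10.2.6) for a DVR) to the forms the assembly
«J1 + F-88 + J3 ⊢ `EmbeddedLiftFact`» consumes:
* `flat_quotient_localization_of_flat_quotient` — truncations of a localisation `B_P` are localisations of the truncations of `B`, hence flat;
* `flat_of_forall_flat_tensor_quotient_pow` — GLOBAL ring form: `B` Noetherian over the DVR `O` with every `(O/𝔪ⁿ⁺¹) ⊗_O B` flat over `O/𝔪ⁿ⁺¹`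
  ⇒ `B` flat over `O` (flatness is local at the maximal ideals `P` of `B`, Mathlib `Module.flat_of_isLocalized_maximal`; `ϖ ∈ P`: lead-2's local
  statement on `B_P`; `ϖ ∉ P`: `ϖ` is a unit in `B_P`, which is then torsion-free = flat over the PID `O`);
* `flat_specMap_of_forall_flat_levels` / `flat_of_forall_flat_levels` — SCHEME form: `g : T → Spec O`, `T` locally Noetherian, every level
  `T ×_O O/𝔪ⁿ⁺¹ → Spec O/𝔪ⁿ⁺¹` (base change along the tree's `Morphisms.infinitesimalNeighbourhood.base 𝔪 n`) flat ⇒ `g` flat (`Flat` is local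
  on the source; on an affine piece `Spec R ×_O Spec O/𝔪ⁿ⁺¹ = Spec (O/𝔪ⁿ⁺¹ ⊗_O R)`, Mathlib `pullbackSpecIso`, `HasRingHomProperty`).
HONEST FRAMING: OURS; NOT a statement of H. Hironaka's 2017 manuscript; AI-written, gate-checked, weaker than expert review. No `sorry`; standard
axioms; DEF-FREE. `--supports stmt-ResolutionOfSingularities-20148 --as helper`.
References (index only): EGA III₁ 0_III (10.2.1)–(10.2.6) (held `paper:doi-10-1007-bf02684273`, pp. 18–19); Mathlib `RingTheory/Flat/Localization`.
-/

set_option linter.dupNamespace false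

noncomputable section

open IsLocalRing TensorProduct

namespace Summit.ResolutionOfSingularities.ResolutionOfSingularities.Cruxes.EquisingularLiftNat.Sections

universe u v

variable {O : Type u} [CommRing O] [IsDomain O] [IsDiscreteValuationRing O]

/-- Truncations of a localisation: if `B ⧸ 𝔪ⁿ⁺¹B` is flat over `O ⧸ 𝔪ⁿ⁺¹`, so is `B_P ⧸ 𝔪ⁿ⁺¹B_P` for every prime `P` of `B`
(it is a localisation of `B ⧸ 𝔪ⁿ⁺¹B`). [folklore] -/
theorem flat_quotient_localization_of_flat_quotient {B : Type v} [CommRing B] [Algebra O B] (P : Ideal B) [P.IsPrime] (n : ℕ)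
    (h : Module.Flat (O ⧸ maximalIdeal O ^ (n + 1)) (B ⧸ (maximalIdeal O ^ (n + 1)).map (algebraMap O B))) :
    Module.Flat (O ⧸ maximalIdeal O ^ (n + 1))
      (Localization.AtPrime P ⧸ (maximalIdeal O ^ (n + 1)).map (algebraMap O (Localization.AtPrime P))) := by
  set p : Ideal O := maximalIdeal O ^ (n + 1) with hp
  set Bp := Localization.AtPrime P
  set JB : Ideal B := p.map (algebraMap O B) with hJB
  -- `B_P ⧸ J_B B_P` is a localisation of `B ⧸ J_B`, hence flat over it, hence flat over `O ⧸ p`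
  haveI : Module.Flat (B ⧸ JB) (Bp ⧸ JB.map (algebraMap B Bp)) :=
    IsLocalization.flat (Bp ⧸ JB.map (algebraMap B Bp)) (Algebra.algebraMapSubmonoid (B ⧸ JB) P.primeCompl)
  letI alg : Algebra (O ⧸ p) (Bp ⧸ JB.map (algebraMap B Bp)) :=
    ((algebraMap (B ⧸ JB) (Bp ⧸ JB.map (algebraMap B Bp))).comp (algebraMap (O ⧸ p) (B ⧸ JB))).toAlgebra
  haveI : IsScalarTower (O ⧸ p) (B ⧸ JB) (Bp ⧸ JB.map (algebraMap B Bp)) := IsScalarTower.of_algebraMap_eq' rfl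
  haveI hflat' : Module.Flat (O ⧸ p) (Bp ⧸ JB.map (algebraMap B Bp)) := Module.Flat.trans (O ⧸ p) (B ⧸ JB) _
  -- transport along `B_P ⧸ J_B B_P = B_P ⧸ p B_P`
  have hJ : JB.map (algebraMap B Bp) = p.map (algebraMap O Bp) := by
    rw [hJB, Ideal.map_map, ← IsScalarTower.algebraMap_eq]
  let e₀ : (Bp ⧸ JB.map (algebraMap B Bp)) ≃+* (Bp ⧸ p.map (algebraMap O Bp)) := Ideal.quotEquivOfEq hJ
  have he₀ : ∀ (c : O ⧸ p) (x : Bp ⧸ JB.map (algebraMap B Bp)), e₀ (c • x) = c • e₀ x := by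
    intro c x
    obtain ⟨a, rfl⟩ := Ideal.Quotient.mk_surjective c
    obtain ⟨y, rfl⟩ := Ideal.Quotient.mk_surjective x
    rw [Algebra.smul_def, Algebra.smul_def, map_mul]
    congr 1
  let e : (Bp ⧸ JB.map (algebraMap B Bp)) ≃ₗ[O ⧸ p] (Bp ⧸ p.map (algebraMap O Bp)) :=
    { e₀ with map_smul' := he₀ }
  exact Module.Flat.of_linearEquiv e.symm

/-- **J3 globalised.** A Noetherian `O`-algebra `B` over a discrete valuation ring `O`, all of whose base changes `(O ⧸ 𝔪ⁿ⁺¹) ⊗_O B` are flat over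
`O ⧸ 𝔪ⁿ⁺¹`, is flat over `O`: flatness is local at the maximal ideals `P` of `B`; if `ϖ ∈ P` the local algebra `B_P` has local structure map and
flat truncations (`flat_quotient_localization_of_flat_quotient`), so res-L1-w45b-lead-2's `flat_of_forall_flat_quotient_pow` (J3, EGA 0_III 10.2.6 for a
DVR) applies; if `ϖ ∉ P` then `ϖ` is a unit in `B_P`, which is therefore torsion-free, i.e. flat, over the PID `O`. [OURS · (T-k) J3 globalised] -/
theorem flat_of_forall_flat_tensor_quotient_pow {B : Type u} [CommRing B] [Algebra O B] [IsNoetherianRing B]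
    (h : ∀ n : ℕ, Module.Flat (O ⧸ maximalIdeal O ^ (n + 1)) ((O ⧸ maximalIdeal O ^ (n + 1)) ⊗[O] B)) :
    Module.Flat O B := by
  have hq : ∀ n : ℕ, Module.Flat (O ⧸ maximalIdeal O ^ (n + 1)) (B ⧸ (maximalIdeal O ^ (n + 1)).map (algebraMap O B)) := by
    intro n
    haveI := h n
    exact Module.Flat.of_linearEquiv (Algebra.TensorProduct.quotIdealMapEquivQuotTensor B (maximalIdeal O ^ (n + 1))).toLinearEquiv
  obtain ⟨ϖ, hϖ⟩ := IsDiscreteValuationRing.exists_irreducible O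
  refine Module.flat_of_isLocalized_maximal (R := O) (S := B) (M := B) (fun P _ => Localization.AtPrime P)
    (fun P _ => Algebra.linearMap B (Localization.AtPrime P)) fun P hP => ?_
  by_cases hϖP : algebraMap O B ϖ ∈ P
  · -- the local case
    haveI : IsLocalHom (algebraMap O (Localization.AtPrime P)) := by
      refine ⟨fun x hx => ?_⟩
      by_contra hxu
      have hxm : x ∈ maximalIdeal O := hxu
      rw [hϖ.maximalIdeal_eq, Ideal.mem_span_singleton'] at hxm
      obtain ⟨y, rfl⟩ := hxm
      have hmem : algebraMap O (Localization.AtPrime P) (y * ϖ) ∈ maximalIdeal (Localization.AtPrime P) := by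
        rw [IsScalarTower.algebraMap_apply O B (Localization.AtPrime P), ← Localization.AtPrime.map_eq_maximalIdeal]
        exact Ideal.mem_map_of_mem _ (by rw [map_mul]; exact Ideal.mul_mem_left _ _ hϖP)
      exact (mem_maximalIdeal _ |>.mp hmem) hx
    exact flat_of_forall_flat_quotient_pow (O := O) (B := Localization.AtPrime P) fun n =>
      flat_quotient_localization_of_flat_quotient P n (hq n)
  · -- `ϖ` is a unit in `B_P`: torsion-free over the PID `O`
    have hunit : IsUnit (algebraMap O (Localization.AtPrime P) ϖ) := by
      rw [IsScalarTower.algebraMap_apply O B (Localization.AtPrime P)]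
      exact IsLocalization.map_units (Localization.AtPrime P) ⟨algebraMap O B ϖ, show algebraMap O B ϖ ∈ P.primeCompl from hϖP⟩
    rw [Module.Flat.flat_iff_torsion_eq_bot_of_isBezout, eq_bot_iff]
    rintro b ⟨⟨r, hr⟩, hrb⟩
    rw [Submodule.mem_bot]
    have hr0 : (r : O) ≠ 0 := nonZeroDivisors.ne_zero hr
    obtain ⟨m, u, hu⟩ := IsDiscreteValuationRing.associated_pow_irreducible hr0 hϖ
    have hrb' : (r : O) • b = 0 := hrb
    have hru : IsUnit (algebraMap O (Localization.AtPrime P) r) := by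
      have h1 : IsUnit (algebraMap O (Localization.AtPrime P) (r * u)) := by
        rw [hu, map_pow]; exact hunit.pow m
      rw [map_mul] at h1
      exact isUnit_of_mul_isUnit_left h1
    rw [Algebra.smul_def] at hrb'
    exact (hru.mul_right_eq_zero).mp hrb'


open CategoryTheory CategoryTheory.Limits AlgebraicGeometry
open Literature.AlgebraicGeometry.Morphisms.infinitesimalNeighbourhood (base)

/-- **J3, affine scheme form.** For `φ : O → R` with `R` Noetherian: if every level `Spec R ×_O Spec O/𝔪ⁿ⁺¹ → Spec O/𝔪ⁿ⁺¹` is flat then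
`Spec φ` is flat (`Spec (O/𝔪ⁿ⁺¹ ⊗_O R) = Spec O/𝔪ⁿ⁺¹ ×_O Spec R`, Mathlib `pullbackSpecIso`, then `flat_of_forall_flat_tensor_quotient_pow`).
[OURS · (T-k) J3, affine scheme form] -/
theorem flat_specMap_of_forall_flat_levels {O : Type} [CommRing O] [IsDomain O] [IsDiscreteValuationRing O]
    {R : CommRingCat.{0}} (hR : IsNoetherianRing Γ(Spec R, ⊤)) (φ : CommRingCat.of O ⟶ R)
    (h : ∀ n : ℕ, Flat (pullback.fst (base (maximalIdeal O) n) (Spec.map φ))) : Flat (Spec.map φ) := by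
  haveI : IsNoetherianRing R := isNoetherianRing_of_ringEquiv _ (Scheme.ΓSpecIso R).commRingCatIsoToRingEquiv
  letI alg : Algebra O R := φ.hom.toAlgebra
  have hφ : CommRingCat.ofHom (algebraMap O R) = φ := rfl
  have hmod : Module.Flat O R := by
    refine flat_of_forall_flat_tensor_quotient_pow (O := O) (B := R) fun n => ?_
    have h1 : Flat (pullback.fst (Spec.map (CommRingCat.ofHom (algebraMap O (O ⧸ maximalIdeal O ^ (n + 1)))))
        (Spec.map (CommRingCat.ofHom (algebraMap O R)))) := by
      rw [hφ]; exact h n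
    have h2 : Flat (Spec.map (CommRingCat.ofHom (algebraMap (O ⧸ maximalIdeal O ^ (n + 1))
        ((O ⧸ maximalIdeal O ^ (n + 1)) ⊗[O] R)))) := by
      rw [← pullbackSpecIso_inv_fst']; infer_instance
    have h3 := (HasRingHomProperty.Spec_iff (P := @Flat)).mp h2
    exact RingHom.flat_algebraMap_iff.mp h3
  rw [← hφ, HasRingHomProperty.Spec_iff (P := @Flat)]
  exact RingHom.flat_algebraMap_iff.mpr hmod

/-- **J3, scheme form.** `O` a DVR, `g : T → Spec O` with `T` locally Noetherian: if every level `T ×_O O/𝔪ⁿ⁺¹ → Spec O/𝔪ⁿ⁺¹` is flat, then `g` is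
flat (`Flat` is local on the source; on an affine piece `flat_specMap_of_forall_flat_levels`). [OURS · (T-k) J3, scheme form] -/
theorem flat_of_forall_flat_levels {O : Type} [CommRing O] [IsDomain O] [IsDiscreteValuationRing O]
    {T : Scheme.{0}} [IsLocallyNoetherian T] (g : T ⟶ Spec (.of O))
    (h : ∀ n : ℕ, Flat (pullback.snd g (base (maximalIdeal O) n))) : Flat g := by
  rw [IsZariskiLocalAtSource.iff_of_openCover (P := @Flat) T.affineCover]
  intro i
  have hnoeth : IsNoetherianRing Γ(T.affineCover.X i, ⊤) :=
    (isLocallyNoetherian_iff_of_affine_openCover T.affineCover).mp inferInstance i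
  set gi : T.affineCover.X i ⟶ Spec (.of O) := T.affineCover.f i ≫ g with hgi
  let φ : CommRingCat.of O ⟶ _ := Spec.preimage gi
  have hφ : Spec.map φ = gi := Spec.map_preimage gi
  -- levelwise flatness of the piece: `Spec R ×_O Spec O/𝔪ⁿ⁺¹ → Spec O/𝔪ⁿ⁺¹`
  have hlev : ∀ n : ℕ, Flat (pullback.fst (base (maximalIdeal O) n) gi) := by
    intro n
    haveI := h n
    have hbig : IsPullback (pullback.fst (T.affineCover.f i) (pullback.fst g (base (maximalIdeal O) n)))
        (pullback.snd (T.affineCover.f i) (pullback.fst g (base (maximalIdeal O) n)) ≫ pullback.snd g (base (maximalIdeal O) n))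
        gi (base (maximalIdeal O) n) := by
      rw [hgi]
      exact (IsPullback.of_hasPullback (T.affineCover.f i) (pullback.fst g (base (maximalIdeal O) n))).paste_vert
        (IsPullback.of_hasPullback g (base (maximalIdeal O) n))
    haveI : Flat (pullback.snd (T.affineCover.f i) (pullback.fst g (base (maximalIdeal O) n)) ≫
        pullback.snd g (base (maximalIdeal O) n)) := inferInstance
    rw [← hbig.flip.isoPullback_inv_fst]
    infer_instance
  rw [← hφ]
  exact flat_specMap_of_forall_flat_levels hnoeth φ (fun n => by rw [hφ]; exact hlev n)

end Summit.ResolutionOfSingularities.ResolutionOfSingularities.Cruxes.EquisingularLiftNat.Sections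

end
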